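import Summits.MatrixMultiplication.MatrixMultiplication.Theorems.AsymptoticRankCWBPerm3Form
import Summits.MatrixMultiplication.MatrixMultiplication.Theorems.AsymptoticRankCWGlueDet3Omega
import Literature.Computability.AlgebraicComplexity.AsymptoticRankBorderRank
import Literature.Computability.AlgebraicComplexity.BorderRankCWDet3Seventeen

/-!
# Known ranges of both sides of `BSkewDominatesCw` / envelope of `stub_skewSquareNine`
(route `MatrixMultiplication/AsymptoticRankCW`; support item `BSkewDominatesCw` =
stmt-MatrixMultiplication-18009, `R̃(T_cw,2) ≤ R̃(ε)`; line `skew_anchor` of the crux `BThesis` =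
stmt-MatrixMultiplication-0588, whose stub `stub_skewSquareNine` is VERBATIM the open crux
`BDet3AsymptoticRank` = stmt-MatrixMultiplication-0591, `R̃(ε ⊠ ε) = 9`)

Notation. `ε` = the Levi-Civita tensor on `Fin 3`, written inline exactly as in the route
(`ε(a,a+1,a+2) = 1`, `ε(a,a+2,a+1) = -1`, indices mod `3`); `T_cw,2 = cwTensor ℂ 2`,
`T_skewcw,2 = skewCwTensor ℂ 1`; `R̃ = asymptoticRank`, `bR = algBorderRank`, `R = tensorRank`.

What is known about the two numbers `R̃(T_cw,2)` and `R̃(ε)` compared by `BSkewDominatesCw`, and about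
`R̃(ε ⊠ ε)` (the subject of `stub_skewSquareNine` / crux 0591), all proved here sorry-free:

* `leviCivitaInline_eq_cast` — the inline tensor is `ε_{abc}` (`leviCivita3`);
* `skewCwTensor_restrictsTo_leviCivita`, `leviCivita_restrictsTo_skewCwTensor` — `ε ≅ T_skewcw,2`
  by the explicit changes of bases `(1, diag(-1,1,1), C)` of Conner–Gesmundo–Landsberg–Ventura 2022,
  §3.2 (`cglv_exists_basis_skewCwTensor_one`) and its inverse; hence
  `asymptoticRank_leviCivita_eq_skewCwTensor : R̃(ε) = R̃(T_skewcw,2)` and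
  `asymptoticRank_leviCivita_sq_eq_skewCw_sq : R̃(ε ⊠ ε) = R̃(T_skewcw,2^{⊗2})` (`ε ⊠ ε ≅ det₃`,
  CGLV Lemma 2.4);
* `asymptoticRank_leviCivita_sq_eq_sq : R̃(ε ⊠ ε) = R̃(ε)²`;
* **upper frame** `asymptoticRank_leviCivita_sq_le_seventeen : R̃(ε ⊠ ε) ≤ 17` — from the
  CERTIFIED border rank bound `bR(T_skewcw,2^{⊗2}) ≤ 17` (`CGLV2022_borderRank_skewCw2_sq_le_holds`,
  the explicit Conner–Huang–Landsberg 2020 §8 expression) and `R̃ ≤ bR`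
  (`asymptoticRank_le_of_algBorderRank_le`); hence
  `asymptoticRank_leviCivita_le_sqrt_seventeen : R̃(ε) ≤ √17 ≈ 4.123`;
* **lower frame** `nine_le_asymptoticRank_leviCivita_sq : 9 ≤ R̃(ε ⊠ ε)` — flattening rank
  `ζ⁽¹⁾(ε) = 3 ≤ R̃(ε)` and squaring;
* the other side: `tensorRank_two_mul_absLeviCivita_le_four` — the symmetric tensor
  `2∑_{σ ∈ 𝔖₃} a_{σ(0)} ⊗ b_{σ(1)} ⊗ c_{σ(2)} ≅ T_cw,2` (CGLV §3.2) has the explicit `4`-term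
  decomposition `(1/2)∑_{s,t = ±1} s t (1,s,t)^{⊗3}`, so
  `asymptoticRank_cwTensor_two_le_four : R̃(T_cw,2) ≤ R(T_cw,2) ≤ 4` (with
  `three_le_asymptoticRank_cwTensor_two`: `3 ≤ R̃(T_cw,2) ≤ 4`).

So `BSkewDominatesCw` compares a number in `[3, 4]` with a number in `[3, √17]`; `stub_skewSquareNine`
asserts that a number in `[9, 17]` equals `9`. Nothing here closes either item.

References: A. Conner, F. Gesmundo, J. M. Landsberg, E. Ventura, comput. complexity 31 (2022) =
arXiv:1909.04785, §1.3, §2.2–2.3, Lemma 2.4, §3.2; A. Conner, H. Huang, J. M. Landsberg,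
arXiv:2009.11391, §8; P. Bürgisser, M. Clausen, M. A. Shokrollahi, *Algebraic Complexity Theory*
(1997), Lemma (15.27).
-/

set_option linter.dupNamespace false

noncomputable section

namespace Summit.MatrixMultiplication.MatrixMultiplication.Theorems

open Module Submodule
open Literature.Computability.AlgebraicComplexity
open Literature.Barriers.MatrixMultiplication (flatteningRank_le_asymptoticRank
  asymptoticRank_kroneckerPow_le)
open Summit.MatrixMultiplication.MatrixMultiplication.Theses.AsymptoticRankCW (BSkewDominatesCw)

/-! ## The inline Levi-Civita tensor and `T_skewcw,2` -/

section LeviCivitaSkew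

/-- The route's inline Levi-Civita tensor is `ε_{abc}` (`leviCivita3`), all `27` entries. [folklore] -/
theorem leviCivitaInline_eq_cast :
    (fun a b c : Fin 3 => (if b = a + 1 ∧ c = a + 2 then (1 : ℂ) else 0) -
        (if b = a + 2 ∧ c = a + 1 then 1 else 0)) =
      fun a b c => ((leviCivita3 a b c : ℤ) : ℂ) := by
  funext a b c
  rw [leviCivita3_eq_table]
  fin_cases a <;> fin_cases b <;> fin_cases c <;> simp [leviCivita3Table]

/-- **`T_skewcw,2 ≥ ε`** (CGLV 2022 §3.2): `(1, B, C) · T_skewcw,2 = ε` with `B = diag(-1,1,1)`,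
`C : c₁ ↦ c₂, c₂ ↦ -c₁` (`cglv_exists_basis_skewCwTensor_one`).
[cite: ConnerGesmundoLandsbergVentura2022, §3.2 (proof of Lemma 2.4)] -/
theorem skewCwTensor_restrictsTo_leviCivita :
    TensorRestrictsTo (skewCwTensor ℂ 1)
      (fun a b c : Fin 3 => (if b = a + 1 ∧ c = a + 2 then (1 : ℂ) else 0) -
        (if b = a + 2 ∧ c = a + 1 then 1 else 0)) := by
  rw [leviCivitaInline_eq_cast]
  obtain ⟨B, C, -, -, hBC⟩ := cglv_exists_basis_skewCwTensor_one
  exact ⟨(1 : Matrix (Fin 3) (Fin 3) ℂ), B, C, fun i j k => (hBC i j k).symm⟩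

/-- **`ε ≥ T_skewcw,2`**: the inverse change of bases `(1, B⁻¹, C⁻¹) = (1, B, Cᵀ)`,
`(1, diag(-1,1,1), Cᵀ) · ε = T_skewcw,2`, so the two tensors are isomorphic (CGLV 2022, p. 7:
"`T_skewcw,2` is the unique up to scale skew-symmetric tensor in `ℂ³ ⊗ ℂ³ ⊗ ℂ³`").
[cite: ConnerGesmundoLandsbergVentura2022, §3.2 (proof of Lemma 2.4)] -/
theorem leviCivita_restrictsTo_skewCwTensor :
    TensorRestrictsTo
      (fun a b c : Fin 3 => (if b = a + 1 ∧ c = a + 2 then (1 : ℂ) else 0) -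
        (if b = a + 2 ∧ c = a + 1 then 1 else 0))
      (skewCwTensor ℂ 1) := by
  rw [leviCivitaInline_eq_cast]
  refine ⟨(1 : Matrix (Fin 3) (Fin 3) ℂ), !![-1, 0, 0; 0, 1, 0; 0, 0, 1],
    !![1, 0, 0; 0, 0, 1; 0, -1, 0], fun i j k => ?_⟩
  fin_cases i <;> fin_cases j <;> fin_cases k <;>
    simp [Fin.sum_univ_three, skewCwTensor, leviCivita3_eq_table, leviCivita3Table,
      Matrix.one_apply]

/-- **`R̃(ε) = R̃(T_skewcw,2)`** (restriction-equivalent tensors have equal asymptotic rank).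
[cite: ConnerGesmundoLandsbergVentura2022, §2.2] -/
theorem asymptoticRank_leviCivita_eq_skewCwTensor :
    asymptoticRank (fun a b c : Fin 3 => (if b = a + 1 ∧ c = a + 2 then (1 : ℂ) else 0) -
        (if b = a + 2 ∧ c = a + 1 then 1 else 0)) = asymptoticRank (skewCwTensor ℂ 1) :=
  asymptoticRank_eq_of_restrictsTo skewCwTensor_restrictsTo_leviCivita
    leviCivita_restrictsTo_skewCwTensor

/-- The reindexed Kronecker square of `T_skewcw,2` is `T_skewcw,2 ⊠ T_skewcw,2` on `(Fin 3 × Fin 3)³`.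
[folklore] -/
theorem squareReindex_kroneckerPow_skewCwTensor :
    squareReindex (kroneckerPow (skewCwTensor ℂ 1) 2) =
      kroneckerTensor (skewCwTensor ℂ 1) (skewCwTensor ℂ 1) := by
  funext a b c
  rw [squareReindex_kroneckerPow_two, kroneckerTensor_apply]

/-- **`R̃(ε ⊠ ε) = R̃(T_skewcw,2^{⊗2})`**: `ε ⊠ ε ≅ T_skewcw,2 ⊠ T_skewcw,2` factorwise
(`TensorRestrictsTo.kronecker`), and the latter is the reindexed `T_skewcw,2^{⊗2}` (`≅ det₃`,
CGLV Lemma 2.4). [cite: ConnerGesmundoLandsbergVentura2022, Lemma 2.4] -/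
theorem asymptoticRank_leviCivita_sq_eq_skewCw_sq :
    asymptoticRank (kroneckerTensor
        (fun a b c : Fin 3 => (if b = a + 1 ∧ c = a + 2 then (1 : ℂ) else 0) -
          (if b = a + 2 ∧ c = a + 1 then 1 else 0))
        (fun a b c : Fin 3 => (if b = a + 1 ∧ c = a + 2 then (1 : ℂ) else 0) -
          (if b = a + 2 ∧ c = a + 1 then 1 else 0))) =
      asymptoticRank (kroneckerPow (skewCwTensor ℂ 1) 2) := by
  have h1 : asymptoticRank (kroneckerTensor
        (fun a b c : Fin 3 => (if b = a + 1 ∧ c = a + 2 then (1 : ℂ) else 0) -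
          (if b = a + 2 ∧ c = a + 1 then 1 else 0))
        (fun a b c : Fin 3 => (if b = a + 1 ∧ c = a + 2 then (1 : ℂ) else 0) -
          (if b = a + 2 ∧ c = a + 1 then 1 else 0))) =
      asymptoticRank (kroneckerTensor (skewCwTensor ℂ 1) (skewCwTensor ℂ 1)) :=
    asymptoticRank_eq_of_restrictsTo
      (skewCwTensor_restrictsTo_leviCivita.kronecker skewCwTensor_restrictsTo_leviCivita)
      (leviCivita_restrictsTo_skewCwTensor.kronecker leviCivita_restrictsTo_skewCwTensor)
  have h2 : asymptoticRank (kroneckerTensor (skewCwTensor ℂ 1) (skewCwTensor ℂ 1)) =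
      asymptoticRank (kroneckerPow (skewCwTensor ℂ 1) 2) := by
    rw [← squareReindex_kroneckerPow_skewCwTensor]
    exact asymptoticRank_eq_of_restrictsTo (restrictsTo_squareReindex _).1
      (restrictsTo_squareReindex _).2
  rw [h1, h2]

/-- **`R̃(ε ⊠ ε) = R̃(ε)²`**: `ε ⊠ ε` is the reindexed `ε^{⊗2}` (restriction both ways) and
`R̃(t^{⊗2}) = R̃(t)²` (`asymptoticRank_kroneckerPow_le`, `pow_asymptoticRank_le_asymptoticRank_kroneckerPow`).
[folklore] -/
theorem asymptoticRank_leviCivita_sq_eq_sq :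
    asymptoticRank (kroneckerTensor
        (fun a b c : Fin 3 => (if b = a + 1 ∧ c = a + 2 then (1 : ℂ) else 0) -
          (if b = a + 2 ∧ c = a + 1 then 1 else 0))
        (fun a b c : Fin 3 => (if b = a + 1 ∧ c = a + 2 then (1 : ℂ) else 0) -
          (if b = a + 2 ∧ c = a + 1 then 1 else 0))) =
      asymptoticRank (fun a b c : Fin 3 => (if b = a + 1 ∧ c = a + 2 then (1 : ℂ) else 0) -
          (if b = a + 2 ∧ c = a + 1 then 1 else 0)) ^ 2 := by
  set t : Fin 3 → Fin 3 → Fin 3 → ℂ := fun a b c =>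
    (if b = a + 1 ∧ c = a + 2 then (1 : ℂ) else 0) - (if b = a + 2 ∧ c = a + 1 then 1 else 0)
  have e : squareReindex (kroneckerPow t 2) = kroneckerTensor t t := by
    funext a b c
    rw [squareReindex_kroneckerPow_two, kroneckerTensor_apply]
  have h1 : asymptoticRank (kroneckerTensor t t) = asymptoticRank (kroneckerPow t 2) := by
    rw [← e]
    exact asymptoticRank_eq_of_restrictsTo (restrictsTo_squareReindex _).1
      (restrictsTo_squareReindex _).2
  rw [h1]
  exact le_antisymm (asymptoticRank_kroneckerPow_le _ (by norm_num))
    (pow_asymptoticRank_le_asymptoticRank_kroneckerPow _ (by norm_num))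

end LeviCivitaSkew

/-! ## The upper frame: `R̃(ε ⊠ ε) ≤ 17`, `R̃(ε) ≤ √17` -/

section Upper

/-- **`R̃(ε ⊠ ε) ≤ 17`**: `R̃(ε ⊠ ε) = R̃(T_skewcw,2^{⊗2}) ≤ bR(T_skewcw,2^{⊗2}) ≤ 17` — the border
rank bound is the certified Conner–Huang–Landsberg expression (`CGLV2022_borderRank_skewCw2_sq_le_holds`;
CGLV 2022 §1.3: `bR(det₃) ≤ 17`), and `R̃ ≤ bR` (BCS 1997, Lemma (15.27)).
[cite: ConnerHuangLandsberg2020, §8] -/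
theorem asymptoticRank_leviCivita_sq_le_seventeen :
    asymptoticRank (kroneckerTensor
        (fun a b c : Fin 3 => (if b = a + 1 ∧ c = a + 2 then (1 : ℂ) else 0) -
          (if b = a + 2 ∧ c = a + 1 then 1 else 0))
        (fun a b c : Fin 3 => (if b = a + 1 ∧ c = a + 2 then (1 : ℂ) else 0) -
          (if b = a + 2 ∧ c = a + 1 then 1 else 0))) ≤ 17 := by
  rw [asymptoticRank_leviCivita_sq_eq_skewCw_sq]
  exact_mod_cast asymptoticRank_le_of_algBorderRank_le CGLV2022_borderRank_skewCw2_sq_le_holds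

/-- **`R̃(ε) ≤ √17`** (`≈ 4.123`; the trivial bound is `R̃(ε) ≤ bR(ε) = 5`): from
`R̃(ε)² = R̃(ε ⊠ ε) ≤ 17`. [cite: ConnerGesmundoLandsbergVentura2022, §1.3] -/
theorem asymptoticRank_leviCivita_le_sqrt_seventeen :
    asymptoticRank (fun a b c : Fin 3 => (if b = a + 1 ∧ c = a + 2 then (1 : ℂ) else 0) -
        (if b = a + 2 ∧ c = a + 1 then 1 else 0)) ≤ Real.sqrt 17 := by
  apply Real.le_sqrt_of_sq_le
  rw [← asymptoticRank_leviCivita_sq_eq_sq]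
  exact asymptoticRank_leviCivita_sq_le_seventeen

end Upper

/-! ## The lower frame: `9 ≤ R̃(ε ⊠ ε)` -/

section Lower

/-- `ζ⁽¹⁾(ε) = 3`: the three `x`-slices of `ε` are linearly independent (slice `a` is the only
one with a non-zero entry at `(a+1, a+2)`). [folklore] -/
private theorem leviCivita_flatteningRank_eq_three :
    flatteningRank (fun a b c : Fin 3 => (if b = a + 1 ∧ c = a + 2 then (1 : ℂ) else 0) -
      (if b = a + 2 ∧ c = a + 1 then 1 else 0)) = 3 := by
  have hli : LinearIndependent ℂ (xSlices (fun a b c : Fin 3 =>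
      (if b = a + 1 ∧ c = a + 2 then (1 : ℂ) else 0) -
        (if b = a + 2 ∧ c = a + 1 then 1 else 0))) := by
    rw [Fintype.linearIndependent_iff]
    intro g hg a
    have hev : ∀ b c : Fin 3, (∑ i : Fin 3, g i * ((if b = i + 1 ∧ c = i + 2 then (1 : ℂ) else 0) -
        (if b = i + 2 ∧ c = i + 1 then 1 else 0))) = 0 := by
      intro b c
      have := congrFun hg (b, c)
      simpa [Finset.sum_apply, Pi.smul_apply, xSlices_apply, smul_eq_mul] using this
    have h := hev (a + 1) (a + 2)
    fin_cases a <;> simpa [Fin.sum_univ_three] using h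
  unfold flatteningRank
  rw [finrank_span_eq_card hli, Fintype.card_fin]

/-- `3 = ζ⁽¹⁾(ε) ≤ R̃(ε)` (flattening rank bounds asymptotic rank from below).
[cite: ChristandlVranaZuiddam2023, Example 1.4] -/
private theorem leviCivita_three_le_asymptoticRank :
    (3 : ℝ) ≤ asymptoticRank (fun a b c : Fin 3 => (if b = a + 1 ∧ c = a + 2 then (1 : ℂ) else 0) -
      (if b = a + 2 ∧ c = a + 1 then 1 else 0)) := by
  have h := flatteningRank_le_asymptoticRank (fun a b c : Fin 3 =>
    (if b = a + 1 ∧ c = a + 2 then (1 : ℂ) else 0) - (if b = a + 2 ∧ c = a + 1 then 1 else 0))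
  rw [leviCivita_flatteningRank_eq_three] at h
  exact_mod_cast h

/-- **`9 ≤ R̃(ε ⊠ ε)`** (the flattening lower bound `ζ⁽¹⁾(det₃) = 9`, here as `R̃(ε ⊠ ε) = R̃(ε)²`
and `3 ≤ R̃(ε)`); with `asymptoticRank_leviCivita_sq_le_seventeen`: `9 ≤ R̃(ε ⊠ ε) ≤ 17` is all
that is known about crux 0591. [cite: ConnerGesmundoLandsbergVentura2022, §2.3] -/
theorem nine_le_asymptoticRank_leviCivita_sq :
    (9 : ℝ) ≤ asymptoticRank (kroneckerTensor
        (fun a b c : Fin 3 => (if b = a + 1 ∧ c = a + 2 then (1 : ℂ) else 0) -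
          (if b = a + 2 ∧ c = a + 1 then 1 else 0))
        (fun a b c : Fin 3 => (if b = a + 1 ∧ c = a + 2 then (1 : ℂ) else 0) -
          (if b = a + 2 ∧ c = a + 1 then 1 else 0))) := by
  rw [asymptoticRank_leviCivita_sq_eq_sq]
  have h3 := leviCivita_three_le_asymptoticRank
  nlinarith [h3]

/-- `3 ≤ R̃(T_skewcw,2) ≤ √17` (both frames transported to the tree's `skewCwTensor ℂ 1`).
[cite: ConnerGesmundoLandsbergVentura2022, §1.3] -/
theorem asymptoticRank_skewCwTensor_one_mem_Icc :
    asymptoticRank (skewCwTensor ℂ 1) ∈ Set.Icc (3 : ℝ) (Real.sqrt 17) := by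
  rw [← asymptoticRank_leviCivita_eq_skewCwTensor]
  exact ⟨leviCivita_three_le_asymptoticRank, asymptoticRank_leviCivita_le_sqrt_seventeen⟩

end Lower

/-! ## The other side: `3 ≤ R̃(T_cw,2) ≤ 4` -/

section Cw

/-- **`R(2∑_σ a_{σ(0)} ⊗ b_{σ(1)} ⊗ c_{σ(2)}) ≤ 4`**: the explicit decomposition
`2|ε| = (1/2)∑_{s,t = ±1} s·t·(1,s,t) ⊗ (1,s,t) ⊗ (1,s,t)` (entry `(i,j,k)` of the right side is
`(1/2)(∑_s s^{n₁+1})(∑_t t^{n₂+1}) = 2·[n₁, n₂ odd] = 2|ε_{ijk}|`, `n_ℓ = #{i,j,k = ℓ}`); this is the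
classical Waring decomposition of the monomial `xyz` into `4` cubes. [folklore] -/
theorem tensorRank_two_mul_absLeviCivita_le_four :
    tensorRank (fun i j k : Fin 3 => 2 * ((|leviCivita3 i j k| : ℤ) : ℂ)) ≤ 4 := by
  refine tensorRank_le_of_eq_sum
    ![![(2 : ℂ)⁻¹, 2⁻¹, 2⁻¹], ![-2⁻¹, -2⁻¹, 2⁻¹], ![-2⁻¹, 2⁻¹, -2⁻¹], ![2⁻¹, -2⁻¹, -2⁻¹]]
    ![![(1 : ℂ), 1, 1], ![1, 1, -1], ![1, -1, 1], ![1, -1, -1]]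
    ![![(1 : ℂ), 1, 1], ![1, 1, -1], ![1, -1, 1], ![1, -1, -1]] ?_
  funext i j k
  fin_cases i <;> fin_cases j <;> fin_cases k <;>
    simp [Finset.sum_apply, Fin.sum_univ_four, triad_apply, abs_leviCivita3] <;> norm_num

/-- **`R̃(T_cw,2) ≤ 4`**: `T_cw,2 ≅ 2∑_σ a_{σ(0)} ⊗ b_{σ(1)} ⊗ c_{σ(2)}` (CGLV 2022 §3.2:
`cwTensor_restrictsTo_levi`, `levi_restrictsTo_cwTensor`), whose rank is `≤ 4`, and
`R̃ ≤ bR ≤ R`. (In fact `R̃(T_cw,2) ≤ bR(T_cw,2) = 4 = R(T_cw,2)`; with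
`three_le_asymptoticRank_cwTensor_two`, `3 ≤ R̃(T_cw,2) ≤ 4`.)
[cite: ConnerGesmundoLandsbergVentura2022, §3.2 (proof of Lemma 2.4)] -/
theorem asymptoticRank_cwTensor_two_le_four : asymptoticRank (cwTensor ℂ 2) ≤ 4 := by
  have h1 : asymptoticRank (cwTensor ℂ 2) =
      asymptoticRank (fun i j k : Fin 3 => 2 * ((|leviCivita3 i j k| : ℤ) : ℂ)) :=
    asymptoticRank_eq_of_restrictsTo levi_restrictsTo_cwTensor cwTensor_restrictsTo_levi
  rw [h1]
  calc asymptoticRank (fun i j k : Fin 3 => 2 * ((|leviCivita3 i j k| : ℤ) : ℂ))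
      ≤ algBorderRank (fun i j k : Fin 3 => 2 * ((|leviCivita3 i j k| : ℤ) : ℂ)) :=
        asymptoticRank_le_algBorderRank _
    _ ≤ tensorRank (fun i j k : Fin 3 => 2 * ((|leviCivita3 i j k| : ℤ) : ℂ)) := by
        exact_mod_cast algBorderRank_le_tensorRank _
    _ ≤ 4 := by exact_mod_cast tensorRank_two_mul_absLeviCivita_le_four

/-- `3 ≤ R̃(T_cw,2) ≤ 4`: the known range of the left side of `BSkewDominatesCw`.
[cite: ConnerGesmundoLandsbergVentura2022, §2.2] -/
theorem asymptoticRank_cwTensor_two_mem_Icc :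
    asymptoticRank (cwTensor ℂ 2) ∈ Set.Icc (3 : ℝ) 4 :=
  ⟨three_le_asymptoticRank_cwTensor_two, asymptoticRank_cwTensor_two_le_four⟩

end Cw

/-! ## The item `BSkewDominatesCw` in terms of the tree's tensors -/

section Item

/-- **`BSkewDominatesCw ↔ R̃(T_cw,2) ≤ R̃(T_skewcw,2)`**: the item's inline `T_cw,2` is
`cwTensor ℂ 2` by `rfl`, and `R̃(ε) = R̃(T_skewcw,2)` (`asymptoticRank_leviCivita_eq_skewCwTensor`).
So the item compares a number in `[3, 4]` (`asymptoticRank_cwTensor_two_mem_Icc`) with a number in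
`[3, √17]` (`asymptoticRank_skewCwTensor_one_mem_Icc`). [cite: ConnerGesmundoLandsbergVentura2022, §2.2] -/
theorem bSkewDominatesCw_iff_cwTensor_le_skewCwTensor :
    BSkewDominatesCw ↔ asymptoticRank (cwTensor ℂ 2) ≤ asymptoticRank (skewCwTensor ℂ 1) := by
  unfold Summit.MatrixMultiplication.MatrixMultiplication.Theses.AsymptoticRankCW.BSkewDominatesCw
  rw [← asymptoticRank_leviCivita_eq_skewCwTensor]
  exact Iff.rfl

/-- A trivial sufficient condition: since `R̃(T_cw,2) ≤ 4`, the item holds as soon as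
`4 ≤ R̃(ε)` (i.e. unless the skew tensor itself saves asymptotically over its rank bound `bR(ε) = 5`
by more than one unit). [folklore] -/
theorem bSkewDominatesCw_of_four_le_asymptoticRank_leviCivita
    (h : (4 : ℝ) ≤ asymptoticRank (fun a b c : Fin 3 =>
      (if b = a + 1 ∧ c = a + 2 then (1 : ℂ) else 0) - (if b = a + 2 ∧ c = a + 1 then 1 else 0))) :
    BSkewDominatesCw := by
  unfold Summit.MatrixMultiplication.MatrixMultiplication.Theses.AsymptoticRankCW.BSkewDominatesCw
  exact asymptoticRank_cwTensor_two_le_four.trans h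

end Item

end Summit.MatrixMultiplication.MatrixMultiplication.Theorems

end
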